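import Summits.AtomisticToContinuum.Crystallization.Theorems.MinimiserShells.Negative.LoadBearing

/-!
# Negative knowledge for crux `MinimiserShells` (stmt-AtomisticToContinuum-9225) — FINITE-RANGE
# mass transport is not enough, at ANY range (standing disprover, gen 3)

`PalmUnimodularRigidity.MinimiserShells`: every minimising (`E_P[h] ≤ e*`) point-stationary
`δ`-hard-core probability law on rooted configurations of `ℝ³` has a `(a/100)`-close-packed root
shell almost surely.  Point-stationarity is the Mecke / mass-transport identity
`E_P Σ_{y ∈ μ} g(μ, y) = E_P Σ_{y ∈ μ} g(θ_y μ, −y)` for EVERY measurable transport `g ≥ 0`.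

Certified here: for every radius `R`, the crux becomes FALSE if the Mecke identity is only assumed
for transports of METRIC RANGE `≤ R`, i.e. for the `g` with `g(μ, y) = 0` whenever `‖y‖ > R`
(`IsLocallyPointStationaryLaw R`; "no mass travels farther than `R`"):
`minimiserShells_false_withLocalMecke : ∀ R, ¬ MinimiserShellsWithLocalMecke R`.

Witness ("far comb"): the DETERMINISTIC law `δ_{count|F}`, `F = {0} ∪ {(R + 3/2 + k/(2m+2))•e₀ : k < m}`
with `m = ⌈−24 (R+2)⁶ e*⌉₊` teeth.  Every tooth lies at distance `> R` from the root, so every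
range-`R` transport out of the root or into the root only sees the root itself: the `R`-local Mecke
identity holds trivially (`isLocallyPointStationaryLaw_dirac_of_far`).  The law is
`1/(2m+2)`-hard-core, its ROOT energy is `≤ −m/(24(R+2)⁶) ≤ e*` (`V_LJ(r) ≤ −1/(12(R+2)⁶)` on
`[1, R+2]`, `lennardJones_le_of_one_le`), and the root shell is EMPTY.  (`R = 0` is the collinear
comb of `Negative.LoadBearing`, which dropped the identity altogether.)

Moral for provers.  The localising power of the Mecke identity lies ENTIRELY in transports of
unbounded range: any proof of the crux must send mass over distances exceeding every fixed `R`
(as the Palm-density transports `g = 1[‖y‖ ≤ R]·…`, `R → ∞`, and the random-grid periodisation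
behind `UnimodularEnergyLowerBound`, cells `L → ∞`, do).  No bookkeeping that only re-roots within a
bounded metric radius — first/second-shell exchanges, bounded-radius star or ring identities —
can combine with `E_P[h] ≤ e*` to give the crux, because all of it is consistent with the far comb.
Since `IsLocallyPointStationaryLaw R` increases to the full identity as `R → ∞` (monotone
convergence), the obstruction sits exactly in the exchange of `R → ∞` with exact minimality.
Supports item stmt-AtomisticToContinuum-9225; workfile `Cruxes/MinimiserShells/Disproof.lean` §9.
-/

noncomputable section

open MeasureTheory
open scoped ENNReal BigOperators

namespace Summit.AtomisticToContinuum.Crystallization.Theorems.MinimiserShells.Negative.LocalMecke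

open Literature.Probability.Process
open Literature.MathematicalPhysics.StatisticalMechanics
open Literature.Geometry.DiscreteGeometry
open Summit.AtomisticToContinuum.Crystallization.Theses.PalmUnimodularRigidity (MinimiserShells)
open Summit.AtomisticToContinuum.Crystallization.Theorems.MinimiserShells.Negative.LoadBearing
  (eStar meanRootEnergy GoodShell minimiserShells_iff not_goodShell_of_far e0
    ae_eq_dirac_count_restrict meanRootEnergy_dirac_count_restrict)

/-- Euclidean 3-space. -/
abbrev E3 := EuclideanSpace ℝ (Fin 3)

/-! ## `R`-local point-stationarity -/

/-- **`R`-local point-stationarity**: the Mecke identity for transports of metric range `≤ R` only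
(`g(μ, y) = 0` whenever `‖y‖ > R`). -/
def IsLocallyPointStationaryLaw (R : ℝ) (P : Measure (Measure E3)) : Prop :=
  ∀ g : Measure E3 → E3 → ℝ≥0∞, Measurable (Function.uncurry g) →
    (∀ μ y, R < ‖y‖ → g μ y = 0) →
    ∫⁻ μ, ∫⁻ y, g μ y ∂μ ∂P = ∫⁻ μ, ∫⁻ y, g (Measure.map (fun z => z - y) μ) (-y) ∂μ ∂P

/-- Point-stationary laws are `R`-locally point-stationary for every `R`. [folklore] -/
theorem isLocallyPointStationaryLaw_of_isPointStationaryLaw {P : Measure (Measure E3)}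
    (h : IsPointStationaryLaw P) (R : ℝ) : IsLocallyPointStationaryLaw R P :=
  fun g hg _ => h g hg

/-- `R`-local point-stationarity is monotone: a larger range is a stronger condition. [folklore] -/
theorem IsLocallyPointStationaryLaw.mono {R R' : ℝ} (hRR' : R ≤ R') {P : Measure (Measure E3)}
    (h : IsLocallyPointStationaryLaw R' P) : IsLocallyPointStationaryLaw R P :=
  fun g hg hgR => h g hg fun μ y hy => hgR μ y (lt_of_le_of_lt hRR' hy)

/-- The crux with point-stationarity WEAKENED to `R`-local point-stationarity. -/
def MinimiserShellsWithLocalMecke (R : ℝ) : Prop :=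
  ∀ δ : ℝ, 0 < δ → ∀ P : Measure (Measure E3), IsProbabilityMeasure P →
    (∀ᵐ μ ∂P, IsRootedHardCore δ μ) → IsLocallyPointStationaryLaw R P → meanRootEnergy P ≤ eStar →
    ∀ᵐ μ ∂P, GoodShell μ

-- (Each local version trivially implies the crux, `IsPointStationaryLaw P` being `R`-local for
-- every `R`; that positive direction is recorded in the workfile `Disproof.lean` only.)

/-- The local versions are monotone in the range. [folklore] -/
theorem MinimiserShellsWithLocalMecke.mono {R R' : ℝ} (hRR' : R ≤ R')
    (h : MinimiserShellsWithLocalMecke R) : MinimiserShellsWithLocalMecke R' :=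
  fun δ hδ P hP hcore hstat hE => h δ hδ P hP hcore (hstat.mono hRR') hE

/-- **Deterministic laws whose non-root points are far are `R`-locally point-stationary**: if `F`
is a finite configuration containing the root all of whose other points have norm `> R`, then
`δ_{count|F}` satisfies the `R`-local Mecke identity (both sides equal `g(count|F, 0)`).
[folklore] -/
theorem isLocallyPointStationaryLaw_dirac_of_far {R : ℝ} {F : Finset E3} (h0 : (0 : E3) ∈ F)
    (hfar : ∀ y ∈ F, y ≠ 0 → R < ‖y‖) :
    IsLocallyPointStationaryLaw R
      (Measure.dirac ((Measure.count : Measure E3).restrict (↑F : Set E3))) := by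
  classical
  intro g _ hgR
  set μ₀ : Measure E3 := (Measure.count : Measure E3).restrict (↑F : Set E3) with hμ₀
  have hae := ae_eq_dirac_count_restrict F
  have ev : ∀ G : Measure E3 → ℝ≥0∞,
      ∫⁻ μ, G μ ∂(Measure.dirac μ₀ : Measure (Measure E3)) = G μ₀ := fun G => by
    rw [lintegral_congr_ae (hae.mono fun μ hμ => by rw [hμ] :
      (fun μ => G μ) =ᵐ[_] fun _ => G μ₀), lintegral_const, measure_univ, mul_one]
  have fin : ∀ k : E3 → ℝ≥0∞, ∫⁻ y, k y ∂μ₀ = ∑ y ∈ F, k y := fun k => by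
    rw [hμ₀, count_restrict_coe_finset, lintegral_finsetSum_measure]
    simp_rw [lintegral_dirac]
  rw [ev fun μ => ∫⁻ y, g μ y ∂μ, ev fun μ => ∫⁻ y, g (Measure.map (fun z => z - y) μ) (-y) ∂μ,
    fin, fin, ← Finset.add_sum_erase F _ h0, ← Finset.add_sum_erase F _ h0]
  have hmap : Measure.map (fun z : E3 => z - 0) μ₀ = μ₀ := by
    simp only [sub_zero]
    exact Measure.map_id
  rw [hmap, neg_zero]
  congr 1
  rw [Finset.sum_eq_zero, Finset.sum_eq_zero]
  · intro y hy
    obtain ⟨hy0, hyF⟩ := Finset.mem_erase.1 hy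
    exact hgR _ _ (by rw [norm_neg]; exact hfar y hyF hy0)
  · intro y hy
    obtain ⟨hy0, hyF⟩ := Finset.mem_erase.1 hy
    exact hgR _ _ (hfar y hyF hy0)

/-! ## The far comb -/

/-- The `k`-th tooth `(R + 3/2 + k/(2(m+1))) • e₀`. -/
def farCombPt (R : ℝ) (m k : ℕ) : E3 := (R + 3 / 2 + (k : ℝ) / (2 * ((m : ℝ) + 1))) • e0

/-- The far comb: the root plus `m` teeth on `[R + 3/2, R + 2)·e₀`. -/
def farComb (R : ℝ) (m : ℕ) : Finset E3 := insert 0 ((Finset.range m).image (farCombPt R m))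

/-- `‖farCombPt R m k‖ = R + 3/2 + k/(2(m+1))`. [folklore] -/
theorem norm_farCombPt {R : ℝ} (hR : 0 ≤ R) (m k : ℕ) :
    ‖farCombPt R m k‖ = R + 3 / 2 + (k : ℝ) / (2 * ((m : ℝ) + 1)) := by
  have he0 : ‖e0‖ = 1 := by simp [e0]
  rw [farCombPt, norm_smul, he0, mul_one, Real.norm_of_nonneg (by positivity)]

/-- Teeth are at distance `≥ R + 3/2` from the root. [folklore] -/
theorem le_norm_farCombPt {R : ℝ} (hR : 0 ≤ R) (m k : ℕ) : R + 3 / 2 ≤ ‖farCombPt R m k‖ := by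
  rw [norm_farCombPt hR]
  have : (0 : ℝ) ≤ (k : ℝ) / (2 * ((m : ℝ) + 1)) := by positivity
  linarith

/-- Teeth are at distance `≤ R + 2` from the root. [folklore] -/
theorem norm_farCombPt_le {R : ℝ} (hR : 0 ≤ R) {m k : ℕ} (hk : k < m) :
    ‖farCombPt R m k‖ ≤ R + 2 := by
  rw [norm_farCombPt hR]
  have hm : (0 : ℝ) < 2 * ((m : ℝ) + 1) := by positivity
  have hk' : (k : ℝ) ≤ (m : ℝ) + 1 := by
    have : (k : ℝ) < m := by exact_mod_cast hk
    linarith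
  have : (k : ℝ) / (2 * ((m : ℝ) + 1)) ≤ 1 / 2 := by
    rw [div_le_iff₀ hm]
    linarith
  linarith

/-- Teeth are not the root. [folklore] -/
theorem farCombPt_ne_zero {R : ℝ} (hR : 0 ≤ R) (m k : ℕ) : farCombPt R m k ≠ 0 := by
  intro h
  have := le_norm_farCombPt hR m k
  rw [h, norm_zero] at this
  linarith

/-- Mutual distances of the teeth. [folklore] -/
theorem dist_farCombPt (R : ℝ) (m k l : ℕ) :
    dist (farCombPt R m k) (farCombPt R m l) = |(k : ℝ) - l| / (2 * ((m : ℝ) + 1)) := by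
  have he0 : ‖e0‖ = 1 := by simp [e0]
  rw [dist_eq_norm, farCombPt, farCombPt, ← sub_smul, norm_smul, he0, mul_one]
  have hm : (0 : ℝ) < 2 * ((m : ℝ) + 1) := by positivity
  rw [show R + 3 / 2 + (k : ℝ) / (2 * ((m : ℝ) + 1)) - (R + 3 / 2 + (l : ℝ) / (2 * ((m : ℝ) + 1))) =
      ((k : ℝ) - l) / (2 * ((m : ℝ) + 1)) by ring, Real.norm_eq_abs, abs_div, abs_of_pos hm]

/-- The teeth are distinct. [folklore] -/
theorem farCombPt_injective (R : ℝ) (m : ℕ) : Function.Injective (farCombPt R m) := by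
  intro k l h
  have hd := dist_farCombPt R m k l
  rw [h, dist_self] at hd
  have hm : (0 : ℝ) < 2 * ((m : ℝ) + 1) := by positivity
  have h0 : |(k : ℝ) - l| = 0 := by
    have := hd.symm
    rwa [div_eq_zero_iff, or_iff_left hm.ne'] at this
  have : (k : ℝ) = l := by
    have := abs_eq_zero.1 h0
    linarith
  exact_mod_cast this

/-- The far comb is `1/(2(m+1))`-separated. [folklore] -/
theorem farComb_separated {R : ℝ} (hR : 0 ≤ R) (m : ℕ) :
    ∀ x ∈ (↑(farComb R m) : Set E3), ∀ y ∈ (↑(farComb R m) : Set E3), x ≠ y →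
      1 / (2 * ((m : ℝ) + 1)) ≤ dist x y := by
  have hm : (0 : ℝ) < 2 * ((m : ℝ) + 1) := by positivity
  have hsmall : 1 / (2 * ((m : ℝ) + 1)) ≤ R + 3 / 2 := by
    rw [div_le_iff₀ hm]
    have : (0 : ℝ) ≤ m := by positivity
    nlinarith
  intro x hx y hy hxy
  simp only [farComb, Finset.coe_insert, Finset.coe_image, Finset.coe_range, Set.mem_insert_iff,
    Set.mem_image, Set.mem_Iio] at hx hy
  rcases hx with rfl | ⟨k, hk, rfl⟩ <;> rcases hy with rfl | ⟨l, hl, rfl⟩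
  · exact absurd rfl hxy
  · rw [dist_comm, dist_zero_right]
    exact hsmall.trans (le_norm_farCombPt hR m l)
  · rw [dist_zero_right]
    exact hsmall.trans (le_norm_farCombPt hR m k)
  · rw [dist_farCombPt]
    have hkl : k ≠ l := fun h => hxy (by rw [h])
    have : (1 : ℝ) ≤ |(k : ℝ) - l| := by
      rcases lt_or_gt_of_ne hkl with h | h
      · have : (k : ℝ) + 1 ≤ l := by exact_mod_cast h
        rw [abs_of_neg (by linarith)]
        linarith
      · have : (l : ℝ) + 1 ≤ k := by exact_mod_cast h
        rw [abs_of_pos (by linarith)]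
        linarith
    exact div_le_div_of_nonneg_right this hm.le

/-- The far comb as a rooted hard-core configuration. [folklore] -/
theorem isRootedHardCore_farComb {R : ℝ} (hR : 0 ≤ R) (m : ℕ) :
    IsRootedHardCore (1 / (2 * ((m : ℝ) + 1)))
      ((Measure.count : Measure E3).restrict (↑(farComb R m) : Set E3)) :=
  ⟨↑(farComb R m), by simp [farComb], farComb_separated hR m, rfl⟩

/-- `V_LJ(r) ≤ −1/(12 ρ⁶)` for `1 ≤ r ≤ ρ` (with `u = r⁻¹ ∈ [ρ⁻¹, 1]`: `u¹² ≤ u⁶`, so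
`V = u¹²/12 − u⁶/6 ≤ −u⁶/12`). [folklore] -/
theorem lennardJones_le_of_one_le {r ρ : ℝ} (h1 : 1 ≤ r) (h2 : r ≤ ρ) :
    lennardJones r ≤ -(1 / (12 * ρ ^ 6)) := by
  have hr : 0 < r := by linarith
  have hρ : 0 < ρ := by linarith
  have hu0 : 0 < r⁻¹ := inv_pos.2 hr
  have hu1 : r⁻¹ ≤ 1 := inv_le_one_of_one_le₀ h1
  have huρ : ρ⁻¹ ≤ r⁻¹ := (inv_le_inv₀ hρ hr).2 h2
  have h6 : (r⁻¹) ^ 6 ≤ 1 := pow_le_one₀ hu0.le hu1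
  have h6ρ : (ρ⁻¹) ^ 6 ≤ (r⁻¹) ^ 6 := pow_le_pow_left₀ (inv_pos.2 hρ).le huρ 6
  have h12 : (r⁻¹) ^ 12 ≤ (r⁻¹) ^ 6 := by
    have : (r⁻¹) ^ 12 = (r⁻¹) ^ 6 * (r⁻¹) ^ 6 := by ring
    rw [this]
    exact mul_le_of_le_one_right (by positivity) h6
  have hρ6 : (ρ⁻¹) ^ 6 = 1 / ρ ^ 6 := by rw [inv_pow, one_div]
  unfold lennardJones
  rw [show -(1 / (12 * ρ ^ 6)) = -(1 / 12) * (ρ⁻¹) ^ 6 by rw [hρ6]; ring]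
  nlinarith [h6ρ, h12]

/-- Root energy of the far comb: `½ Σ_y V_LJ(‖y‖) ≤ −m/(24 (R+2)⁶)`. [folklore] -/
theorem rootEnergy_farComb_le {R : ℝ} (hR : 0 ≤ R) (m : ℕ) :
    (∫ y, lennardJones ‖y‖ ∂((Measure.count : Measure E3).restrict (↑(farComb R m) : Set E3))) / 2
      ≤ -((m : ℝ) / (24 * (R + 2) ^ 6)) := by
  rw [integral_count_restrict_coe_finset]
  have h0 : (0 : E3) ∉ (Finset.range m).image (farCombPt R m) := by
    simp only [Finset.mem_image, Finset.mem_range, not_exists, not_and]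
    exact fun k _ => farCombPt_ne_zero hR m k
  rw [farComb, Finset.sum_insert h0, norm_zero, lennardJones_zero, zero_add,
    Finset.sum_image fun k _ l _ h => farCombPt_injective R m h]
  have hle : ∑ k ∈ Finset.range m, lennardJones ‖farCombPt R m k‖ ≤
      ∑ k ∈ Finset.range m, (-(1 / (12 * (R + 2) ^ 6)) : ℝ) :=
    Finset.sum_le_sum fun k hk => lennardJones_le_of_one_le
      (by linarith [le_norm_farCombPt hR m k]) (norm_farCombPt_le hR (Finset.mem_range.1 hk))
  rw [Finset.sum_const, Finset.card_range, nsmul_eq_mul] at hle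
  have hρ : (0 : ℝ) < 24 * (R + 2) ^ 6 := by positivity
  have : (m : ℝ) * -(1 / (12 * (R + 2) ^ 6)) = -(2 * ((m : ℝ) / (24 * (R + 2) ^ 6))) := by
    field_simp
    ring
  rw [this] at hle
  linarith

/-- The far comb's root shell is empty, hence bad. [folklore] -/
theorem not_goodShell_farComb {R : ℝ} (hR : 0 ≤ R) (m : ℕ) :
    ¬ GoodShell ((Measure.count : Measure E3).restrict (↑(farComb R m) : Set E3)) := by
  refine not_goodShell_of_far fun y hy hy0 => ?_
  rw [count_restrict_singleton_ne_zero_iff] at hy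
  simp only [farComb, Finset.coe_insert, Finset.coe_image, Finset.coe_range, Set.mem_insert_iff,
    Set.mem_image, Set.mem_Iio] at hy
  rcases hy with rfl | ⟨k, -, rfl⟩
  · exact absurd rfl hy0
  · exact lt_of_lt_of_le (by linarith) (le_norm_farCombPt hR m k)

/-- Teeth of the far comb are farther than `R` from the root. [folklore] -/
theorem far_of_mem_farComb {R : ℝ} (hR : 0 ≤ R) (m : ℕ) :
    ∀ y ∈ farComb R m, y ≠ 0 → R < ‖y‖ := by
  intro y hy hy0
  simp only [farComb, Finset.mem_insert, Finset.mem_image, Finset.mem_range] at hy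
  rcases hy with rfl | ⟨k, -, rfl⟩
  · exact absurd rfl hy0
  · exact lt_of_lt_of_le (by linarith) (le_norm_farCombPt hR m k)

/-- The number of teeth that beats `e*` at range `R`: `⌈−24 (R+2)⁶ e*⌉₊`. -/
def farCombSize (R : ℝ) : ℕ := ⌈-(24 * (R + 2) ^ 6) * eStar⌉₊

/-- With `farCombSize R` teeth the root energy is `≤ e*`. [folklore] -/
theorem rootEnergy_farComb_le_eStar {R : ℝ} (hR : 0 ≤ R) :
    (∫ y, lennardJones ‖y‖ ∂((Measure.count : Measure E3).restrict
      (↑(farComb R (farCombSize R)) : Set E3))) / 2 ≤ eStar := by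
  have h1 := rootEnergy_farComb_le hR (farCombSize R)
  have h2 : -(24 * (R + 2) ^ 6) * eStar ≤ (farCombSize R : ℝ) := Nat.le_ceil _
  have hρ : (0 : ℝ) < 24 * (R + 2) ^ 6 := by positivity
  have h3 : -((farCombSize R : ℝ) / (24 * (R + 2) ^ 6)) ≤ eStar := by
    rw [neg_le, le_div_iff₀ hρ]
    linarith
  exact h1.trans h3

/-! ## The refutation of every local version -/

/-- The local version at a non-negative range is false (far comb at that range). [folklore] -/
theorem minimiserShells_false_withLocalMecke_of_nonneg {R : ℝ} (hR : 0 ≤ R) :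
    ¬ MinimiserShellsWithLocalMecke R := by
  intro h
  set F := farComb R (farCombSize R)
  have hae := ae_eq_dirac_count_restrict F
  have hE : meanRootEnergy (Measure.dirac ((Measure.count : Measure E3).restrict (↑F : Set E3)))
      ≤ eStar := by
    rw [meanRootEnergy_dirac_count_restrict]
    exact rootEnergy_farComb_le_eStar hR
  have hgood := h _ (by positivity : (0 : ℝ) < 1 / (2 * ((farCombSize R : ℝ) + 1))) _ inferInstance
    (hae.mono fun μ hμ => by rw [hμ]; exact isRootedHardCore_farComb hR (farCombSize R))
    (isLocallyPointStationaryLaw_dirac_of_far (by simp [F, farComb])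
      (far_of_mem_farComb hR (farCombSize R))) hE
  obtain ⟨μ, hμg, hμe⟩ := (hgood.and hae).exists
  rw [hμe] at hμg
  exact not_goodShell_farComb hR (farCombSize R) hμg

/-- **Finite-range mass transport is not enough, at any range.** For every `R`, the crux with the
Mecke identity assumed only for transports vanishing beyond distance `R` is FALSE. [folklore] -/
theorem minimiserShells_false_withLocalMecke (R : ℝ) : ¬ MinimiserShellsWithLocalMecke R :=
  fun h => minimiserShells_false_withLocalMecke_of_nonneg (le_max_right R 0) (h.mono (le_max_left R 0))

end Summit.AtomisticToContinuum.Crystallization.Theorems.MinimiserShells.Negative.LocalMecke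

end
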